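import Summits.ValiantsHypothesis.ValiantsHypothesis.Theorems.DefinabilityGapZeroSpecialisation
import HarnessLib

/-!
# DefinabilityGap — the ZERO-PATTERN RUNG for the planted Kabanets–Impagliazzo permanent design (unconditional)

Route `route-ValiantsHypothesis-DefinabilityGap` (decomp-valiant cycle 1, lens 5, gen 7), supporting the hitting item
`KIPlantedHitting` (stmt-ValiantsHypothesis-23547) through its size road R_K1.1.

After the specialisation `y_W ↦ 0` (`DefinabilityGapZeroSpecialisation`) a cell `x ∈ S_c` is LIVE for `c` iff some
transversal of the block `S_c` through `x` avoids `W`; dead cells occur in no monomial of `P_c^W`. This file proves the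
TOP-LIVE-CELL lemma (the `π`-top live cell of a block lies on its specialised leading diagonal) and packages the criterion as

**`kiPer_algebraicIndependent_of_zeroPattern`**: given a zero set `W`, an injective height `h` on the seed cells and for
every `c ∈ T` a position `p₀ c` with (live) a `W`-avoiding transversal of `S_c` through `p₀ c`, (top) every OTHER live cell
of `S_c` lower than `x_c := E_c (p₀ c)`, (tri) `h x_c < h x_{c'}` whenever `x_c` is a live cell of another `c' ∈ T` — the
block permanents `(P_c)_{c ∈ T}` are algebraically independent over `ℂ`.

`W = ∅` is the peeling rung of gen 5 (`DefinabilityGapLexCertificate.kiPer_algebraicIndependent_of_ranking`). New instances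
(lens-5 g7 instrument `v7/instrument-zero.md`): ONE gadget row (`m − 1` zeros) certifies the union of two parallel
translation classes (`2q` curves, every cell on exactly two curves — no `W = ∅` ranking is triangular there), and the
order-free ONE-COLUMN PIVOT CERTIFICATE (each curve gets a pivot row, zeroed off a fixed column; distinct pivot cells; a
`W`-avoiding transversal in each pivot minor — then (tri) is vacuous because every other curve is DEAD at each pivot)
certifies every tested family with `|T| ≤ 2q+1` for `m ≥ 6`. 0 sorry.
-/

noncomputable section

open MvPolynomial
open Literature.Computability.AlgebraicComplexity Literature.Computability.MetaComplexity
open Summit.ValiantsHypothesis.ValiantsHypothesis.Theorems.DefinabilityGapAffineRung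
open Summit.ValiantsHypothesis.ValiantsHypothesis.Theorems.DefinabilityGapLexCertificate
open Summit.ValiantsHypothesis.ValiantsHypothesis.Theorems.DefinabilityGapZeroSpecialisation

namespace Summit.ValiantsHypothesis.ValiantsHypothesis.Theorems.DefinabilityGapZeroPattern

variable {τ : Type*} [LinearOrder τ] [WellFoundedGT τ]

/-! ## 6. The top LIVE cell of a block lies on its specialised leading diagonal; the zero-pattern rung -/

/-- **Top-live-cell lemma.** If `p₀` is live (some `W`-avoiding transversal of `S_c` passes through it) and `π`-above every
other live cell of `S_c`, then it belongs to the specialised leading diagonal `d_c^{W,π}`. [this file] -/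
theorem leadExpZ_topLiveCell (m : ℕ) {W : Finset (Fin (qOf m) × Fin (qOf m))} {π : (Fin (qOf m) × Fin (qOf m)) → τ}
    (hπ : Function.Injective π) (c : Fin 3 → Fin (qOf m)) (p₀ : Fin m × Fin m)
    (hlive : ∃ ρ ∈ avoidSet m W c, ρ p₀.2 = p₀.1)
    (htop : ∀ p, p ≠ p₀ → (∃ ρ ∈ avoidSet m W c, ρ p.2 = p.1) → π (cellEmb m c p₀) < π (cellEmb m c p)) :
    leadExpZ m W π c (π (cellEmb m c p₀)) = 1 := by
  classical
  have hinj : Function.Injective (π ∘ (cellEmb m c)) := hπ.comp (cellEmb m c).injective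
  obtain ⟨ρ₀, hρ₀A, hρ₀⟩ := hlive
  have hA : (avoidSet m W c).Nonempty := ⟨ρ₀, hρ₀A⟩
  obtain ⟨ρ, hρA, hρ⟩ := exists_leadExpZ_eq m hπ c hA
  -- values below the top live cell vanish for every AVOIDING ranked pattern of the block
  have hlow : ∀ ρ' ∈ avoidSet m W c, ∀ j : τ, j < π (cellEmb m c p₀) →
      Finsupp.mapDomain (π ∘ (cellEmb m c)) (permMonomial ρ') j = 0 := by
    intro ρ' hρ' j hj
    by_contra hne
    have hmem : j ∈ (Finsupp.mapDomain (π ∘ (cellEmb m c)) (permMonomial ρ')).support :=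
      Finsupp.mem_support_iff.2 hne
    rw [Finsupp.mapDomain_support_of_injective hinj] at hmem
    obtain ⟨p, hp, rfl⟩ := Finset.mem_image.1 hmem
    by_cases hpp : p = p₀
    · subst hpp
      exact lt_irrefl _ hj
    · have h1 := Finsupp.mem_support_iff.1 hp
      have hl : ∃ ρ ∈ avoidSet m W c, ρ p.2 = p.1 := by
        refine ⟨ρ', hρ', ?_⟩
        obtain ⟨a, b⟩ := p
        rw [permMonomial_apply] at h1
        by_contra h2
        exact h1 (if_neg h2)
      exact lt_asymm hj (htop p hpp hl)
  -- the competitor: an avoiding diagonal through `p₀`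
  set u : τ →₀ ℕ := Finsupp.mapDomain (π ∘ (cellEmb m c)) (permMonomial ρ₀) with hu
  have hu_top : u (π (cellEmb m c p₀)) = 1 := by
    have h1 : u ((π ∘ (cellEmb m c)) p₀) = permMonomial ρ₀ p₀ := Finsupp.mapDomain_apply hinj _ p₀
    rw [Function.comp_apply] at h1
    rw [h1]
    obtain ⟨a, b⟩ := p₀
    rw [permMonomial_apply, if_pos hρ₀]
  have hu_supp : u ∈ (kiPerZ m W π c).support := by
    rw [mem_support_iff, hu, coeff_kiPerZ_of_mem m hπ c hρ₀A]
    exact one_ne_zero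
  have hle : (lexOrdR τ).toSyn u ≤ (lexOrdR τ).toSyn (leadExpZ m W π c) := (lexOrdR τ).le_degree hu_supp
  have hle' : toLex u ≤ toLex (leadExpZ m W π c) := MonomialOrder.lex_le_iff.1 hle
  have h01 := leadExpZ_apply_le_one m hπ c hA (π (cellEmb m c p₀))
  by_contra hne
  have h0 : leadExpZ m W π c (π (cellEmb m c p₀)) = 0 := by omega
  have hlt : toLex (leadExpZ m W π c) < toLex u := by
    refine Finsupp.lex_def.2 ⟨π (cellEmb m c p₀), fun j hj => ?_, ?_⟩
    · show leadExpZ m W π c j = u j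
      rw [hρ, hlow ρ hρA j hj, hu, hlow ρ₀ hρ₀A j hj]
    · show leadExpZ m W π c (π (cellEmb m c p₀)) < u (π (cellEmb m c p₀))
      rw [h0, hu_top]
      exact zero_lt_one
  exact absurd hlt (not_lt.2 hle')

/-- **Triangular criterion (specialised).** Live top cells `x_c = cellEmb m c (p₀ c)` with `π(x_{c'}) < π(x_c)` whenever
`x_c` is a LIVE cell of another `c' ∈ T` make the specialised leading diagonals linearly independent. [this file] -/
theorem linearIndependent_leadVecZ_of_topLiveCells (m : ℕ) {W : Finset (Fin (qOf m) × Fin (qOf m))}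
    {π : (Fin (qOf m) × Fin (qOf m)) → τ} (hπ : Function.Injective π) (T : Finset (Fin 3 → Fin (qOf m)))
    (p₀ : (Fin 3 → Fin (qOf m)) → Fin m × Fin m)
    (hlive : ∀ c ∈ T, ∃ ρ ∈ avoidSet m W c, ρ (p₀ c).2 = (p₀ c).1)
    (htop : ∀ c ∈ T, ∀ p, p ≠ p₀ c → (∃ ρ ∈ avoidSet m W c, ρ p.2 = p.1) →
      π (cellEmb m c (p₀ c)) < π (cellEmb m c p))
    (htri : ∀ c ∈ T, ∀ c' ∈ T, c' ≠ c → ∀ p, cellEmb m c' p = cellEmb m c (p₀ c) →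
      (∃ ρ ∈ avoidSet m W c', ρ p.2 = p.1) → π (cellEmb m c' (p₀ c')) < π (cellEmb m c (p₀ c))) :
    LinearIndependent ℚ (fun c : T => leadVecZ m W π (c : Fin 3 → Fin (qOf m))) := by
  classical
  rw [Fintype.linearIndependent_iff]
  intro g hg
  by_contra hne
  obtain ⟨i₀, hi₀⟩ := not_forall.1 hne
  obtain ⟨c, hcS, hcmin⟩ := Finset.exists_min_image (Finset.univ.filter fun i : T => g i ≠ 0)
    (fun i : T => π (cellEmb m (i : Fin 3 → Fin (qOf m)) (p₀ i))) ⟨i₀, by simpa using hi₀⟩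
  have hgc : g c ≠ 0 := (Finset.mem_filter.1 hcS).2
  have hx := congr_fun hg (π (cellEmb m (c : Fin 3 → Fin (qOf m)) (p₀ c)))
  rw [Finset.sum_apply, Pi.zero_apply] at hx
  simp_rw [Pi.smul_apply, smul_eq_mul] at hx
  rw [Finset.sum_eq_single c] at hx
  · have h1 := leadExpZ_topLiveCell m hπ (c : Fin 3 → Fin (qOf m)) (p₀ c) (hlive c c.2) (htop c c.2)
    simp only [leadVecZ, h1, Nat.cast_one, mul_one] at hx
    exact hgc hx
  · intro c' _ hc'c
    by_cases hg' : g c' = 0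
    · rw [hg', zero_mul]
    · have h0 : leadExpZ m W π (c' : Fin 3 → Fin (qOf m)) (π (cellEmb m (c : Fin 3 → Fin (qOf m)) (p₀ c))) = 0 := by
        by_contra h1
        obtain ⟨ρ', hρ'A, -⟩ := hlive c' c'.2
        obtain ⟨p, hp, hl⟩ := live_of_leadExpZ_ne_zero m hπ (c' : Fin 3 → Fin (qOf m)) ⟨ρ', hρ'A⟩ h1
        have hp' : cellEmb m (c' : Fin 3 → Fin (qOf m)) p = cellEmb m (c : Fin 3 → Fin (qOf m)) (p₀ c) := hπ hp
        have hlt := htri c c.2 c' c'.2 (fun h => hc'c (Subtype.ext h)) p hp' hl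
        exact (not_lt.2 (hcmin c' (by simpa using hg'))) hlt
      simp only [leadVecZ, h0, Nat.cast_zero, mul_zero]
  · intro h
    exact absurd (Finset.mem_univ c) h

/-- Ranked form of the zero-pattern criterion. [this file] -/
theorem kiPer_algebraicIndependent_of_topLiveCells (m : ℕ) {W : Finset (Fin (qOf m) × Fin (qOf m))}
    {π : (Fin (qOf m) × Fin (qOf m)) → τ} (hπ : Function.Injective π) (T : Finset (Fin 3 → Fin (qOf m)))
    (p₀ : (Fin 3 → Fin (qOf m)) → Fin m × Fin m)
    (hlive : ∀ c ∈ T, ∃ ρ ∈ avoidSet m W c, ρ (p₀ c).2 = (p₀ c).1)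
    (htop : ∀ c ∈ T, ∀ p, p ≠ p₀ c → (∃ ρ ∈ avoidSet m W c, ρ p.2 = p.1) →
      π (cellEmb m c (p₀ c)) < π (cellEmb m c p))
    (htri : ∀ c ∈ T, ∀ c' ∈ T, c' ≠ c → ∀ p, cellEmb m c' p = cellEmb m c (p₀ c) →
      (∃ ρ ∈ avoidSet m W c', ρ p.2 = p.1) → π (cellEmb m c' (p₀ c')) < π (cellEmb m c (p₀ c))) :
    AlgebraicIndependent ℂ (fun c : T => kiPer m (c : Fin 3 → Fin (qOf m))) :=
  kiPer_algebraicIndependent_of_linearIndependentZ m hπ T (fun c hc => (hlive c hc).imp fun _ h => h.1)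
    (linearIndependent_leadVecZ_of_topLiveCells m hπ T p₀ hlive htop htri)

/-- **THE ZERO-PATTERN RUNG (unconditional, size-free, kernel).** Data: a zero set `W` of seed cells, an injective height
`h` on the seed cells, and for every coordinate `c ∈ T` a position `p₀ c` of its block such that
(live) some transversal of `S_c` avoiding `W` passes through `p₀ c`;
(top) every other live position `p` of `S_c` (on some `W`-avoiding transversal) has `h (E_c p) < h (E_c (p₀ c))`;
(tri) whenever the cell `E_c (p₀ c)` is a live cell `E_{c'} p` of another `c' ∈ T`, `h (E_c (p₀ c)) < h (E_{c'} (p₀ c'))`.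
Then the block permanents `(per_m(y|S_c))_{c ∈ T}` of the planted generator are algebraically independent over `ℂ`.
`W = ∅` is the peeling rung `DefinabilityGapLexCertificate.kiPer_algebraicIndependent_of_ranking`; the ONE-COLUMN PIVOT
certificate (every `c` gets a pivot row whose other cells are put into `W`; distinct pivot cells; a transversal in every
pivot minor avoiding `W`) is the case where (tri) is vacuous because every other curve is DEAD at each pivot. [this file] -/
theorem kiPer_algebraicIndependent_of_zeroPattern (m : ℕ) (T : Finset (Fin 3 → Fin (qOf m)))
    (W : Finset (Fin (qOf m) × Fin (qOf m))) (h : (Fin (qOf m) × Fin (qOf m)) → ℕ) (hh : Function.Injective h)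
    (p₀ : (Fin 3 → Fin (qOf m)) → Fin m × Fin m)
    (hlive : ∀ c ∈ T, ∃ ρ : Equiv.Perm (Fin m), (∀ i, cellEmb m c (ρ i, i) ∉ W) ∧ ρ (p₀ c).2 = (p₀ c).1)
    (htop : ∀ c ∈ T, ∀ p, p ≠ p₀ c →
      (∃ ρ : Equiv.Perm (Fin m), (∀ i, cellEmb m c (ρ i, i) ∉ W) ∧ ρ p.2 = p.1) →
      h (cellEmb m c p) < h (cellEmb m c (p₀ c)))
    (htri : ∀ c ∈ T, ∀ c' ∈ T, c' ≠ c → ∀ p, cellEmb m c' p = cellEmb m c (p₀ c) →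
      (∃ ρ : Equiv.Perm (Fin m), (∀ i, cellEmb m c' (ρ i, i) ∉ W) ∧ ρ p.2 = p.1) →
      h (cellEmb m c (p₀ c)) < h (cellEmb m c' (p₀ c'))) :
    AlgebraicIndependent ℂ (fun c : T => kiPer m (c : Fin 3 → Fin (qOf m))) := by
  have e1 : ∀ (c : Fin 3 → Fin (qOf m)) (p : Fin m × Fin m),
      (∃ ρ ∈ avoidSet m W c, ρ p.2 = p.1) ↔
      (∃ ρ : Equiv.Perm (Fin m), (∀ i, cellEmb m c (ρ i, i) ∉ W) ∧ ρ p.2 = p.1) := fun c p =>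
    ⟨fun ⟨ρ, hρ, h1⟩ => ⟨ρ, mem_avoidSet.1 hρ, h1⟩, fun ⟨ρ, hρ, h1⟩ => ⟨ρ, mem_avoidSet.2 hρ, h1⟩⟩
  refine kiPer_algebraicIndependent_of_topLiveCells (τ := ℕᵒᵈ) m (W := W) (π := OrderDual.toDual ∘ h)
    (OrderDual.toDual.injective.comp hh) T p₀ ?_ ?_ ?_
  · intro c hc
    exact (e1 c (p₀ c)).2 (hlive c hc)
  · intro c hc p hp hl
    exact OrderDual.toDual_lt_toDual.2 (htop c hc p hp ((e1 c p).1 hl))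
  · intro c hc c' hc' hne p hp hl
    exact OrderDual.toDual_lt_toDual.2 (htri c hc c' hc' hne p hp ((e1 c' p).1 hl))

end Summit.ValiantsHypothesis.ValiantsHypothesis.Theorems.DefinabilityGapZeroPattern

end
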